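import Mathlib
import Literature.Barriers.MatrixMultiplication.NormalizerBarrier
import Summits.MatrixMultiplication.MatrixMultiplication.Theorems.LieRankDesigns.Negative.Basics
import Summits.MatrixMultiplication.MatrixMultiplication.Theorems.SubgroupIdentityDesigns.Negative.ScalarLaw

/-!
# Projective reduction of the subgroup TPP (all `p`, all `m ≥ 1`)

Route `LevelGradedCohnUmans`, crux `SubgroupIdentityDesigns` (stmt-MatrixMultiplication-14079),
negative side / census infrastructure.  A witness of the crux is a subgroup-TPP triple
`(H₁, H₂, H₃)` in `GL_m(𝔽_p)`; the scalar law (`ScalarLaw.scalar_law`) says the scalar parts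
`Sᵢ = Hᵢ ∩ Z` (`Z` = the scalar matrices) have pairwise coprime orders with `|S₁||S₂||S₃| ∣ p - 1`.
This file proves that in the extremal case `|S₁||S₂||S₃| = p - 1` — the case of EVERY profile that
survives the order sieve of the `(2,1)` cell (`p = 31`: `z = (3,2,5)`; `p = 61`: `z = (3,4,5)`) — the
TPP is a PROJECTIVE condition:

* `subgroupTPP_of_quotient` (LIFTING, any group, any normal `N`): TPP of the images in `G ⧸ N`
  together with TPP of the parts `Hᵢ ∩ N` implies TPP of `(H₁, H₂, H₃)`;
* `map_quotient_subgroupTPP_of_cover` (DESCENT, `N` central): if every `z ∈ N` is a product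
  `s₁ s₂ s₃` with `sᵢ ∈ Hᵢ ∩ N`, then TPP of `(H₁, H₂, H₃)` implies TPP of the images;
* `subgroupTPP_of_coprime` : three subgroups of a finite commutative group with pairwise coprime
  orders are TPP (orders of elements);
* `subgroupTPP_iff_projective` : **for `H₁, H₂, H₃ ≤ GL_m(𝔽_p)` whose scalar parts have pairwise
  coprime orders with product `p - 1`, `SubgroupTPP H₁ H₂ H₃ ↔ SubgroupTPP` of the images in
  `PGL_m(𝔽_p) = GL_m(𝔽_p) ⧸ Z`.**

Consequence for the census: TPP triples of a sieve profile are enumerated up to conjugacy in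
`PGL_2(𝔽_p)` (a factor `(p-1)` smaller per member), which is how the `p = 61` profile was first
shown TPP-realisable (kit job j126628) before the direct `GL_2(61)` census (j126886 / j126920).
VALUE = THEOREM (structure of every witness), NOT summit progress; the crux item is untouched and
remains open.  Report: `run/shared/lean/b2b/levelgraded-cu/ORACLE-g16.md` §G16-2.
-/

set_option linter.dupNamespace false

noncomputable section

open scoped Classical

open Summit.MatrixMultiplication.MatrixMultiplication.Theorems.LieRankDesigns.Negative (GLm Mat)

open Literature.Barriers.MatrixMultiplication (SubgroupTPP)

namespace Summit.MatrixMultiplication.MatrixMultiplication.Theorems.SubgroupIdentityDesigns.Negative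

section Abstract

variable {G : Type*} [Group G]

/-- **LIFTING.**  For any normal subgroup `N`: if the images of `H₁, H₂, H₃` in `G ⧸ N` are TPP
and the parts `Hᵢ ∩ N` are TPP, then `(H₁, H₂, H₃)` is TPP.  (A relation `abc = 1` maps to a
relation of the images, so `a, b, c ∈ N`; then it is a relation of the parts.) -/
theorem subgroupTPP_of_quotient (N : Subgroup G) [N.Normal] {H₁ H₂ H₃ : Subgroup G}
    (hproj : SubgroupTPP (H₁.map (QuotientGroup.mk' N)) (H₂.map (QuotientGroup.mk' N))
      (H₃.map (QuotientGroup.mk' N)))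
    (hscal : SubgroupTPP (H₁ ⊓ N) (H₂ ⊓ N) (H₃ ⊓ N)) : SubgroupTPP H₁ H₂ H₃ := by
  intro a ha b hb c hc habc
  have himg : (QuotientGroup.mk' N a) * (QuotientGroup.mk' N b) * (QuotientGroup.mk' N c) = 1 := by
    rw [← map_mul, ← map_mul, habc, map_one]
  obtain ⟨h1a, h1b, h1c⟩ := hproj _ (Subgroup.mem_map_of_mem _ ha) _
    (Subgroup.mem_map_of_mem _ hb) _ (Subgroup.mem_map_of_mem _ hc) himg
  rw [QuotientGroup.mk'_apply, QuotientGroup.eq_one_iff] at h1a h1b h1c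
  exact hscal a (Subgroup.mem_inf.mpr ⟨ha, h1a⟩) b (Subgroup.mem_inf.mpr ⟨hb, h1b⟩)
    c (Subgroup.mem_inf.mpr ⟨hc, h1c⟩) habc

/-- **DESCENT.**  For a central subgroup `N` such that every `z ∈ N` is a product `s₁ s₂ s₃`
with `sᵢ ∈ Hᵢ ∩ N`: if `(H₁, H₂, H₃)` is TPP then so are the images in `G ⧸ N`.  (A relation of
the images lifts to `abc = z = s₁ s₂ s₃`; centrality gives the relation
`(s₁⁻¹a)(s₂⁻¹b)(s₃⁻¹c) = 1`, so `a = s₁ ∈ N`, etc.) -/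
theorem map_quotient_subgroupTPP_of_cover (N : Subgroup G) [N.Normal]
    (hN : N ≤ Subgroup.center G) {H₁ H₂ H₃ : Subgroup G} (htpp : SubgroupTPP H₁ H₂ H₃)
    (hcover : ∀ z ∈ N, ∃ s₁ ∈ H₁ ⊓ N, ∃ s₂ ∈ H₂ ⊓ N, ∃ s₃ ∈ H₃ ⊓ N, s₁ * s₂ * s₃ = z) :
    SubgroupTPP (H₁.map (QuotientGroup.mk' N)) (H₂.map (QuotientGroup.mk' N))
      (H₃.map (QuotientGroup.mk' N)) := by
  rintro _ ⟨a, ha, rfl⟩ _ ⟨b, hb, rfl⟩ _ ⟨c, hc, rfl⟩ h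
  have habc : a * b * c ∈ N := by
    rw [← QuotientGroup.eq_one_iff, ← QuotientGroup.mk'_apply, map_mul, map_mul]; exact h
  obtain ⟨s₁, hs₁, s₂, hs₂, s₃, hs₃, hs⟩ := hcover _ habc
  rw [Subgroup.mem_inf] at hs₁ hs₂ hs₃
  have z₁ := Subgroup.mem_center_iff.mp (hN hs₁.2)
  have z₂ := Subgroup.mem_center_iff.mp (hN hs₂.2)
  have z₂' := Subgroup.mem_center_iff.mp ((Subgroup.center G).inv_mem (hN hs₂.2))
  have z₃' := Subgroup.mem_center_iff.mp ((Subgroup.center G).inv_mem (hN hs₃.2))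
  have key : (s₁⁻¹ * a) * (s₂⁻¹ * b) * (s₃⁻¹ * c) = 1 := by
    calc (s₁⁻¹ * a) * (s₂⁻¹ * b) * (s₃⁻¹ * c)
        = s₁⁻¹ * (a * s₂⁻¹) * b * (s₃⁻¹ * c) := by simp only [mul_assoc]
      _ = s₁⁻¹ * (s₂⁻¹ * a) * b * (s₃⁻¹ * c) := by rw [z₂' a]
      _ = s₁⁻¹ * s₂⁻¹ * ((a * b) * s₃⁻¹) * c := by simp only [mul_assoc]
      _ = s₁⁻¹ * s₂⁻¹ * (s₃⁻¹ * (a * b)) * c := by rw [z₃' (a * b)]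
      _ = s₁⁻¹ * s₂⁻¹ * s₃⁻¹ * (s₁ * s₂ * s₃) := by rw [hs]; simp only [mul_assoc]
      _ = s₁⁻¹ * s₂⁻¹ * (s₃⁻¹ * s₁) * (s₂ * s₃) := by simp only [mul_assoc]
      _ = s₁⁻¹ * s₂⁻¹ * (s₁ * s₃⁻¹) * (s₂ * s₃) := by rw [z₁ s₃⁻¹]
      _ = s₁⁻¹ * (s₂⁻¹ * s₁) * (s₃⁻¹ * (s₂ * s₃)) := by simp only [mul_assoc]
      _ = s₁⁻¹ * (s₁ * s₂⁻¹) * (s₃⁻¹ * (s₂ * s₃)) := by rw [z₁ s₂⁻¹]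
      _ = s₂⁻¹ * ((s₃⁻¹ * s₂) * s₃) := by simp only [mul_assoc, inv_mul_cancel_left]
      _ = s₂⁻¹ * ((s₂ * s₃⁻¹) * s₃) := by rw [z₂ s₃⁻¹]
      _ = 1 := by simp only [mul_assoc, inv_mul_cancel_left, inv_mul_cancel]
  obtain ⟨e₁, e₂, e₃⟩ := htpp _ (H₁.mul_mem (H₁.inv_mem hs₁.1) ha) _
    (H₂.mul_mem (H₂.inv_mem hs₂.1) hb) _ (H₃.mul_mem (H₃.inv_mem hs₃.1) hc) key
  refine ⟨?_, ?_, ?_⟩ <;> rw [QuotientGroup.mk'_apply, QuotientGroup.eq_one_iff]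
  · exact (inv_mul_eq_one.mp e₁) ▸ hs₁.2
  · exact (inv_mul_eq_one.mp e₂) ▸ hs₂.2
  · exact (inv_mul_eq_one.mp e₃) ▸ hs₃.2

/-- Three subgroups of a finite commutative group with PAIRWISE COPRIME orders are TPP:
in a relation `abc = 1` the order of `a = (bc)⁻¹` divides `|A|` and `|B||C|`, so `a = 1`; then
`b = c⁻¹` has order dividing `|B|` and `|C|`. -/
theorem subgroupTPP_of_coprime {K : Type*} [CommGroup K] [Finite K] {A B C : Subgroup K}
    (hAB : (Nat.card A).Coprime (Nat.card B)) (hAC : (Nat.card A).Coprime (Nat.card C))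
    (hBC : (Nat.card B).Coprime (Nat.card C)) : SubgroupTPP A B C := by
  intro a ha b hb c hc habc
  have oa : orderOf a ∣ Nat.card A := Subgroup.orderOf_dvd_natCard A ha
  have ob : orderOf b ∣ Nat.card B := Subgroup.orderOf_dvd_natCard B hb
  have oc : orderOf c ∣ Nat.card C := Subgroup.orderOf_dvd_natCard C hc
  have ha' : a = (b * c)⁻¹ := eq_inv_of_mul_eq_one_left (by rw [← mul_assoc]; exact habc)
  have oa' : orderOf a ∣ Nat.card B * Nat.card C := by
    rw [ha', orderOf_inv]
    exact ((Commute.all b c).orderOf_mul_dvd_lcm).trans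
      ((Nat.lcm_dvd_mul _ _).trans (Nat.mul_dvd_mul ob oc))
  have a1 : a = 1 := by
    have hd : orderOf a ∣ Nat.gcd (Nat.card A) (Nat.card B * Nat.card C) := Nat.dvd_gcd oa oa'
    rw [Nat.Coprime.gcd_eq_one (Nat.Coprime.mul_right hAB hAC), Nat.dvd_one] at hd
    exact orderOf_eq_one_iff.mp hd
  have hbc : b * c = 1 := by rw [a1, one_mul] at habc; exact habc
  have hb' : b = c⁻¹ := eq_inv_of_mul_eq_one_left hbc
  have b1 : b = 1 := by
    have hd : orderOf b ∣ Nat.gcd (Nat.card B) (Nat.card C) :=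
      Nat.dvd_gcd ob (by rw [hb', orderOf_inv]; exact oc)
    rw [Nat.Coprime.gcd_eq_one hBC, Nat.dvd_one] at hd
    exact orderOf_eq_one_iff.mp hd
  refine ⟨a1, b1, ?_⟩
  rw [b1, one_mul] at hbc
  exact hbc

end Abstract

section Matrices

variable {p : ℕ} [hp : Fact p.Prime] {m : ℕ}

/-- The scalar matrices form a central subgroup of `GL_m(𝔽_p)`. -/
theorem range_scalarHom_le_center : (scalarHom p m).range ≤ Subgroup.center (GLm p m) := by
  rintro _ ⟨u, rfl⟩
  rw [Subgroup.mem_center_iff]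
  intro g
  exact (scalarHom_comm u g).symm

/-- The scalar matrices form a normal subgroup of `GL_m(𝔽_p)` (the quotient is `PGL_m(𝔽_p)`). -/
instance range_scalarHom_normal : ((scalarHom p m).range).Normal := by
  refine ⟨fun n hn g => ?_⟩
  obtain ⟨u, rfl⟩ := hn
  rw [← scalarHom_comm u g, mul_inv_cancel_right]
  exact ⟨u, rfl⟩

/-- The parts `Hᵢ ∩ Z` are TPP as soon as the scalar parts `Sᵢ = Hᵢ.comap scalarHom ≤ 𝔽_pˣ` have
pairwise coprime orders (`m ≥ 1`). -/
theorem subgroupTPP_inf_scalars [NeZero m] {H₁ H₂ H₃ : Subgroup (GLm p m)}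
    (h₁₂ : (Nat.card (H₁.comap (scalarHom p m))).Coprime (Nat.card (H₂.comap (scalarHom p m))))
    (h₁₃ : (Nat.card (H₁.comap (scalarHom p m))).Coprime (Nat.card (H₃.comap (scalarHom p m))))
    (h₂₃ : (Nat.card (H₂.comap (scalarHom p m))).Coprime (Nat.card (H₃.comap (scalarHom p m)))) :
    SubgroupTPP (H₁ ⊓ (scalarHom p m).range) (H₂ ⊓ (scalarHom p m).range)
      (H₃ ⊓ (scalarHom p m).range) := by
  have hS := subgroupTPP_of_coprime h₁₂ h₁₃ h₂₃
  rintro a ⟨ha, ⟨u, rfl⟩⟩ b ⟨hb, ⟨v, rfl⟩⟩ c ⟨hc, ⟨w, rfl⟩⟩ habc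
  have huvw : u * v * w = 1 := scalarHom_injective (by rw [map_mul, map_mul, habc, map_one])
  obtain ⟨hu, hv, hw⟩ := hS u (Subgroup.mem_comap.mpr ha) v (Subgroup.mem_comap.mpr hb)
    w (Subgroup.mem_comap.mpr hc) huvw
  subst hu; subst hv; subst hw
  exact ⟨map_one _, map_one _, map_one _⟩

/-- If the scalar parts of a subgroup-TPP triple have `|S₁||S₂||S₃| = p - 1` (`m ≥ 1`), then
every scalar matrix is a product `s₁ s₂ s₃` with `sᵢ ∈ Hᵢ ∩ Z` (`S₁ S₂ S₃ = 𝔽_pˣ` by counting: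
the join has order divisible by the pairwise coprime `|Sᵢ|`). -/
theorem scalar_cover [NeZero m] {H₁ H₂ H₃ : Subgroup (GLm p m)} (htpp : SubgroupTPP H₁ H₂ H₃)
    (hfull : Nat.card (H₁.comap (scalarHom p m)) * Nat.card (H₂.comap (scalarHom p m)) *
      Nat.card (H₃.comap (scalarHom p m)) = p - 1) :
    ∀ z ∈ (scalarHom p m).range, ∃ s₁ ∈ H₁ ⊓ (scalarHom p m).range,
      ∃ s₂ ∈ H₂ ⊓ (scalarHom p m).range, ∃ s₃ ∈ H₃ ⊓ (scalarHom p m).range, s₁ * s₂ * s₃ = z := by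
  obtain ⟨c₁₂, c₁₃, c₂₃, -⟩ := scalar_law htpp
  set S₁ := H₁.comap (scalarHom p m) with hS₁
  set S₂ := H₂.comap (scalarHom p m) with hS₂
  set S₃ := H₃.comap (scalarHom p m) with hS₃
  have hG : Nat.card (ZMod p)ˣ = p - 1 := by
    rw [Nat.card_eq_fintype_card, ZMod.card_units p]
  have hJ : Nat.card (S₁ ⊔ S₂ ⊔ S₃ : Subgroup (ZMod p)ˣ) = p - 1 := by
    apply Nat.dvd_antisymm
    · rw [← hG]; exact Subgroup.card_subgroup_dvd_card _
    · rw [← hfull]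
      have d₁ : Nat.card S₁ ∣ Nat.card (S₁ ⊔ S₂ ⊔ S₃ : Subgroup (ZMod p)ˣ) :=
        Subgroup.card_dvd_of_le (le_sup_left.trans le_sup_left)
      have d₂ : Nat.card S₂ ∣ Nat.card (S₁ ⊔ S₂ ⊔ S₃ : Subgroup (ZMod p)ˣ) :=
        Subgroup.card_dvd_of_le (le_sup_right.trans le_sup_left)
      have d₃ : Nat.card S₃ ∣ Nat.card (S₁ ⊔ S₂ ⊔ S₃ : Subgroup (ZMod p)ˣ) :=
        Subgroup.card_dvd_of_le le_sup_right
      exact Nat.Coprime.mul_dvd_of_dvd_of_dvd (Nat.coprime_mul_iff_left.mpr ⟨c₁₃, c₂₃⟩)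
        (Nat.Coprime.mul_dvd_of_dvd_of_dvd c₁₂ d₁ d₂) d₃
  have htop : (S₁ ⊔ S₂ ⊔ S₃ : Subgroup (ZMod p)ˣ) = ⊤ :=
    Subgroup.eq_top_of_card_eq _ (by rw [hJ, hG])
  rintro _ ⟨u, rfl⟩
  have hu : u ∈ (S₁ ⊔ S₂ ⊔ S₃ : Subgroup (ZMod p)ˣ) := by rw [htop]; exact Subgroup.mem_top u
  obtain ⟨y, hy, w, hw, rfl⟩ := Subgroup.mem_sup.mp hu
  obtain ⟨u₁, hu₁, v, hv, rfl⟩ := Subgroup.mem_sup.mp hy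
  refine ⟨scalarHom p m u₁, Subgroup.mem_inf.mpr ⟨Subgroup.mem_comap.mp hu₁, u₁, rfl⟩,
    scalarHom p m v, Subgroup.mem_inf.mpr ⟨Subgroup.mem_comap.mp hv, v, rfl⟩,
    scalarHom p m w, Subgroup.mem_inf.mpr ⟨Subgroup.mem_comap.mp hw, w, rfl⟩, ?_⟩
  rw [map_mul, map_mul]

/-- **PROJECTIVE REDUCTION OF THE SUBGROUP TPP.**  Let `H₁, H₂, H₃ ≤ GL_m(𝔽_p)` (`m ≥ 1`) have
scalar parts of pairwise coprime orders with `|S₁||S₂||S₃| = p - 1` (the extremal case of the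
scalar law; e.g. `z = (3,2,5)` at `p = 31`, `z = (3,4,5)` at `p = 61`).  Then `(H₁, H₂, H₃)` is
subgroup-TPP **iff** its images in `PGL_m(𝔽_p) = GL_m(𝔽_p) ⧸ Z` are subgroup-TPP. -/
theorem subgroupTPP_iff_projective [NeZero m] {H₁ H₂ H₃ : Subgroup (GLm p m)}
    (h₁₂ : (Nat.card (H₁.comap (scalarHom p m))).Coprime (Nat.card (H₂.comap (scalarHom p m))))
    (h₁₃ : (Nat.card (H₁.comap (scalarHom p m))).Coprime (Nat.card (H₃.comap (scalarHom p m))))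
    (h₂₃ : (Nat.card (H₂.comap (scalarHom p m))).Coprime (Nat.card (H₃.comap (scalarHom p m))))
    (hfull : Nat.card (H₁.comap (scalarHom p m)) * Nat.card (H₂.comap (scalarHom p m)) *
      Nat.card (H₃.comap (scalarHom p m)) = p - 1) :
    SubgroupTPP H₁ H₂ H₃ ↔
      SubgroupTPP (H₁.map (QuotientGroup.mk' (scalarHom p m).range))
        (H₂.map (QuotientGroup.mk' (scalarHom p m).range))
        (H₃.map (QuotientGroup.mk' (scalarHom p m).range)) :=
  ⟨fun htpp => map_quotient_subgroupTPP_of_cover _ range_scalarHom_le_center htpp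
      (scalar_cover htpp hfull),
    fun hproj => subgroupTPP_of_quotient _ hproj (subgroupTPP_inf_scalars h₁₂ h₁₃ h₂₃)⟩

/-- The unconditional half most used by a census: projective TPP of the images plus pairwise
coprime scalar parts already give the subgroup TPP (no hypothesis on the product of the orders). -/
theorem subgroupTPP_of_projective [NeZero m] {H₁ H₂ H₃ : Subgroup (GLm p m)}
    (h₁₂ : (Nat.card (H₁.comap (scalarHom p m))).Coprime (Nat.card (H₂.comap (scalarHom p m))))
    (h₁₃ : (Nat.card (H₁.comap (scalarHom p m))).Coprime (Nat.card (H₃.comap (scalarHom p m))))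
    (h₂₃ : (Nat.card (H₂.comap (scalarHom p m))).Coprime (Nat.card (H₃.comap (scalarHom p m))))
    (hproj : SubgroupTPP (H₁.map (QuotientGroup.mk' (scalarHom p m).range))
        (H₂.map (QuotientGroup.mk' (scalarHom p m).range))
        (H₃.map (QuotientGroup.mk' (scalarHom p m).range))) :
    SubgroupTPP H₁ H₂ H₃ :=
  subgroupTPP_of_quotient _ hproj (subgroupTPP_inf_scalars h₁₂ h₁₃ h₂₃)

end Matrices

end Summit.MatrixMultiplication.MatrixMultiplication.Theorems.SubgroupIdentityDesigns.Negative

end
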